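import Summits.BirchSwinnertonDyer.BirchSwinnertonDyer.Theorems.ManinLocalTwoThreeShimuraIndexBadPrimeSieve
import HarnessLib

/-!
# The bad-prime sieve at an odd prime: the unique split prime, the `ℓ = 3` level profile, and «`3` and `5` never both
divide the Shimura index» (cell bsd-f2-manin, es g43, ROAD γ continued)

Notation as in `…Theorems.ManinLocalTwoThreeShimuraIndexBadPrimeSieve` (`Λ₀(f) = periodLattice f`, `Λ₁(f) = periodLatticeGamma1 f`,
`¬ ShimuraIndexPrimeTo ℓ f` = «`ℓ ∣ [Λ₀(f):Λ₁(f)]`», `a_p(f) = cuspCoeff f p`).  Everything here is a COROLLARY of the landed sieve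
(`ShimuraSieve.dvd_sub_of_not_shimuraIndexPrimeTo`: `ℓ ∣ a_p(f) − p` for all `p ∣ N`) and of THEOREM AL (`atkinLehnerShimuraSignLaw_holds`:
for odd `ℓ` exactly one prime of `N` has Atkin–Lehner sign `−1`).

## §1 Odd `ℓ`, any newform (no curve, no optimality)
* `level_profile` — every `p ∣ N` is `ℓ` (and then `ℓ² ∣ N`), or simple SPLIT (`a_p = +1`, `ℓ ∣ p − 1`, sign `−1`), or simple NON-SPLIT
  (`a_p = −1`, `ℓ ∣ p + 1`, sign `+1`) (any prime `ℓ`);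
* `split_prime_unique` — for odd `ℓ` at most ONE prime of `N` is split;
* `exists_split_prime_of_not_sq_dvd` — for odd `ℓ` with `ℓ² ∤ N` (equivalently `ℓ ∤ N`) the level is squarefree and has EXACTLY one split
  prime `q`, `q ≡ 1 (mod ℓ)`; all other `p ∣ N` are `≡ −1 (mod ℓ)` and non-split.
## §2 `ℓ = 3` (the C3 side of the cell: a `3` in the Shimura index lives on `N = 3^e · q^δ · ∏ pᵢ`, `e ≠ 1`, `q ≡ 1 (3)` split and unique,
  `pᵢ ≡ 2 (3)` non-split, and `e = 0 ⟹ δ = 1`): `level_profile_three`, `nine_dvd_of_three_dvd`, `exists_split_prime_three`.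
## §3 Two odd primes at once: `cuspCoeff_eleven_of_three` / `not_eleven_dvd_of_three_of_five` (newform-only: `3 ∣ [Λ₀:Λ₁]` and `5 ∣ [Λ₀:Λ₁]`
  force `11 ∤ N` and `N` squarefree), hence with ROAD β transported (tree `ShimuraFive.eleven_dvd_level_of_not_shimuraIndexPrimeTo_five_of_squarefree`,
  which FORCES `11 ∣ N`): **`not_three_and_five`** — for every `X₀(N)`-datum of a minimal curve (NO optimality hypothesis) `3` and `5` do not both
  divide `[Λ₀(f):Λ₁(f)]`; with the tree's `shimuraIndexPrimeTo_of_seven_le_datum` (support `⊆ {2,3,5}`) the odd part of the Shimura exponent is a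
  power of a single prime.
Census (HOME/es/E15-LATTICE-INDEX-v1.tsv, 1025 classes, N ≤ 19870): `3 ∣ n` at 23 classes, all with the §2 profile (unique split prime `≡ 1 (3)`
whenever `9 ∤ N`: 21/21; `9 ∣ N` at 27a, 54a); `15 ∣ n` at 0 classes (max `n = 5`).  BSD is not proved here; C2/C3 untouched.
-/

set_option autoImplicit false
set_option linter.dupNamespace false

noncomputable section

open scoped Classical MatrixGroups ModularForm

open CongruenceSubgroup Complex WeierstrassCurve Literature.NumberTheory.EllipticCurves
  Literature.NumberTheory.EllipticCurves.ModularForms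
open Summit.BirchSwinnertonDyer.Rank1Residual.ManinAdditive Summit.BirchSwinnertonDyer.Rank1Residual.ManinAdditive.KatoCurve
open Summit.BirchSwinnertonDyer.BirchSwinnertonDyer.Theorems.ManinLocalTwoThree

namespace Summit.BirchSwinnertonDyer.BirchSwinnertonDyer.Theorems.ManinLocalTwoThree.ShimuraSieve

/-! ## §1 Odd `ℓ`: the level profile and the unique split prime -/

section Odd

variable {N : ℕ} [NeZero N]

/-- **LEVEL PROFILE at a prime `ℓ ∣ [Λ₀(f):Λ₁(f)]`** (any newform): a prime `p ∣ N` is `ℓ` itself with `ℓ² ∣ N`, or a simple split prime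
(`a_p = +1`, `ℓ ∣ p − 1`, Atkin–Lehner sign `−1`), or a simple non-split prime (`a_p = −1`, `ℓ ∣ p + 1`, sign `+1`).
[cite: LingOesterle1991, Thm. 6] [cite: AtkinLehner1970, Thm. 3] -/
theorem level_profile {f : CuspForm (Gamma0 N) 2} (hf : IsNewform0 f) {ℓ : ℕ} (hℓ : ℓ.Prime) (hS : ¬ ShimuraIndexPrimeTo ℓ f)
    {p : ℕ} (hp : p.Prime) (hpN : p ∣ N) :
    (p = ℓ ∧ ℓ ^ 2 ∣ N) ∨
      (¬ p ^ 2 ∣ N ∧ cuspCoeff f p = 1 ∧ (ℓ : ℤ) ∣ (p : ℤ) - 1 ∧ atkinLehnerEigenvalueAt f p = -1) ∨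
      (¬ p ^ 2 ∣ N ∧ cuspCoeff f p = -1 ∧ (ℓ : ℤ) ∣ (p : ℤ) + 1 ∧ atkinLehnerEigenvalueAt f p = 1) := by
  by_cases hp2 : p ^ 2 ∣ N
  · have hpl : p = ℓ := eq_of_sq_dvd_of_not_shimuraIndexPrimeTo hf hℓ hS hp hp2
    subst hpl
    exact Or.inl ⟨rfl, hp2⟩
  · have hε := atkinLehnerEigenvalueAt_eq_neg_cuspCoeff hf hp hpN hp2
    rcases cuspCoeff_eq_of_not_sq_dvd_of_not_shimuraIndexPrimeTo hf hℓ hS hp hpN hp2 with ⟨ha, hd⟩ | ⟨ha, hd⟩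
    · exact Or.inr (Or.inl ⟨hp2, ha, hd, by rw [hε, ha]⟩)
    · exact Or.inr (Or.inr ⟨hp2, ha, hd, by rw [hε, ha]; norm_num⟩)

/-- A split prime of the level is simple (`a_p = +1 ≠ 0`). -/
theorem not_sq_dvd_of_cuspCoeff_eq_one {f : CuspForm (Gamma0 N) 2} (hf : IsNewform0 f) {p : ℕ} (hp : p.Prime)
    (hap : cuspCoeff f p = 1) : ¬ p ^ 2 ∣ N := by
  intro hp2
  have h0 := hf.cuspCoeff_eq_zero_of_sq_dvd hp hp2
  rw [hap] at h0
  exact one_ne_zero h0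

/-- **At most one split prime** for an odd `ℓ ∣ [Λ₀(f):Λ₁(f)]` (THEOREM AL: only one Atkin–Lehner sign `−1`).
[cite: ByeonKim2014, Prop. 4.1] [cite: LingOesterle1991, Thm. 3 and Thm. 6] -/
theorem split_prime_unique {f : CuspForm (Gamma0 N) 2} (hf : IsNewform0 f) {ℓ : ℕ} (hℓ : ℓ.Prime) (hℓ2 : ℓ ≠ 2)
    (hS : ¬ ShimuraIndexPrimeTo ℓ f) {p q : ℕ} (hp : p.Prime) (hpN : p ∣ N) (hap : cuspCoeff f p = 1) (hq : q.Prime) (hqN : q ∣ N)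
    (haq : cuspCoeff f q = 1) : p = q := by
  by_contra hpq
  obtain ⟨ha, -⟩ := cuspCoeff_eq_neg_one_of_ne_of_not_shimuraIndexPrimeTo hf hℓ hℓ2 hS hq hqN
    (not_sq_dvd_of_cuspCoeff_eq_one hf hq haq) haq hp hpN (not_sq_dvd_of_cuspCoeff_eq_one hf hp hap) hpq
  rw [hap] at ha
  norm_num at ha

/-- If `ℓ² ∤ N` then the level is squarefree (§1 of the sieve: `p² ∣ N ⟹ p = ℓ`). -/
theorem squarefree_of_not_sq_dvd {f : CuspForm (Gamma0 N) 2} (hf : IsNewform0 f) {ℓ : ℕ} (hℓ : ℓ.Prime)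
    (hS : ¬ ShimuraIndexPrimeTo ℓ f) (hℓN : ¬ ℓ ^ 2 ∣ N) : Squarefree N := by
  rw [Nat.squarefree_iff_prime_squarefree]
  intro p hp hpp
  have hp2 : p ^ 2 ∣ N := by simpa [sq] using hpp
  exact hℓN ((eq_of_sq_dvd_of_not_shimuraIndexPrimeTo hf hℓ hS hp hp2) ▸ hp2)

/-- **Exactly one split prime when `ℓ ∤ N`.**  For an odd `ℓ ∣ [Λ₀(f):Λ₁(f)]` with `ℓ² ∤ N`: there is a prime `q ∥ N` with `a_q(f) = +1` and
`ℓ ∣ q − 1` (the unique sign-`−1` prime of THEOREM AL is multiplicative, hence split), and every other prime `p ∣ N` is simple, non-split,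
`ℓ ∣ p + 1`. [cite: ByeonKim2014, Prop. 4.1] [cite: LingOesterle1991, Thm. 3 and Thm. 6] [cite: AtkinLehner1970, Thm. 3] -/
theorem exists_split_prime_of_not_sq_dvd {f : CuspForm (Gamma0 N) 2} (hf : IsNewform0 f) {ℓ : ℕ} (hℓ : ℓ.Prime) (hℓ2 : ℓ ≠ 2)
    (hS : ¬ ShimuraIndexPrimeTo ℓ f) (hℓN : ¬ ℓ ^ 2 ∣ N) :
    ∃ q : ℕ, q.Prime ∧ q ∣ N ∧ ¬ q ^ 2 ∣ N ∧ cuspCoeff f q = 1 ∧ (ℓ : ℤ) ∣ (q : ℤ) - 1 ∧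
      ∀ p : ℕ, p.Prime → p ∣ N → p ≠ q → (¬ p ^ 2 ∣ N ∧ cuspCoeff f p = -1 ∧ (ℓ : ℤ) ∣ (p : ℤ) + 1) := by
  obtain ⟨q₀, ⟨hq₀, hq₀N, hε⟩, -⟩ := atkinLehnerShimuraSignLaw_holds N f hf ℓ hℓ hℓ2 hS
  have hnsq : ∀ p : ℕ, p.Prime → ¬ p ^ 2 ∣ N := fun p hp h ↦
    hℓN ((eq_of_sq_dvd_of_not_shimuraIndexPrimeTo hf hℓ hS hp h) ▸ h)
  have haq : cuspCoeff f q₀ = 1 ∧ (ℓ : ℤ) ∣ (q₀ : ℤ) - 1 := by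
    rcases cuspCoeff_eq_of_not_sq_dvd_of_not_shimuraIndexPrimeTo hf hℓ hS hq₀ hq₀N (hnsq q₀ hq₀) with h | ⟨ha, -⟩
    · exact h
    · rw [atkinLehnerEigenvalueAt_eq_neg_cuspCoeff hf hq₀ hq₀N (hnsq q₀ hq₀), ha] at hε
      norm_num at hε
  refine ⟨q₀, hq₀, hq₀N, hnsq q₀ hq₀, haq.1, haq.2, fun p hp hpN hpq ↦ ⟨hnsq p hp, ?_⟩⟩
  exact cuspCoeff_eq_neg_one_of_ne_of_not_shimuraIndexPrimeTo hf hℓ hℓ2 hS hq₀ hq₀N (hnsq q₀ hq₀) haq.1 hp hpN (hnsq p hp) hpq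

end Odd

/-! ## §2 `ℓ = 3` -/

section Three

variable {N : ℕ} [NeZero N]

/-- **The `ℓ = 3` level profile**: `3 ∣ [Λ₀(f):Λ₁(f)]` puts every `p ∣ N` in one of: `p = 3` with `9 ∣ N`; `p ∥ N` split with `p ≡ 1 (mod 3)`
(sign `−1`); `p ∥ N` non-split with `p ≡ 2 (mod 3)` (sign `+1`).  [cite: LingOesterle1991, Thm. 6] [cite: AtkinLehner1970, Thm. 3] -/
theorem level_profile_three {f : CuspForm (Gamma0 N) 2} (hf : IsNewform0 f) (hS : ¬ ShimuraIndexPrimeTo 3 f) {p : ℕ} (hp : p.Prime)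
    (hpN : p ∣ N) :
    (p = 3 ∧ 9 ∣ N) ∨ (¬ p ^ 2 ∣ N ∧ cuspCoeff f p = 1 ∧ p % 3 = 1 ∧ atkinLehnerEigenvalueAt f p = -1) ∨
      (¬ p ^ 2 ∣ N ∧ cuspCoeff f p = -1 ∧ p % 3 = 2 ∧ atkinLehnerEigenvalueAt f p = 1) := by
  rcases level_profile hf (by norm_num) hS hp hpN with ⟨rfl, h9⟩ | ⟨hp2, ha, hd, hε⟩ | ⟨hp2, ha, hd, hε⟩
  · exact Or.inl ⟨rfl, by simpa using h9⟩
  · exact Or.inr (Or.inl ⟨hp2, ha, by omega, hε⟩)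
  · exact Or.inr (Or.inr ⟨hp2, ha, by omega, hε⟩)

/-- `3 ∣ [Λ₀:Λ₁]` and `3 ∣ N` force `9 ∣ N`. -/
theorem nine_dvd_of_three_dvd {f : CuspForm (Gamma0 N) 2} (hf : IsNewform0 f) (hS : ¬ ShimuraIndexPrimeTo 3 f) (h3 : 3 ∣ N) :
    9 ∣ N := by
  simpa using sq_dvd_of_dvd_of_not_shimuraIndexPrimeTo hf (by norm_num) hS h3

/-- **`9 ∤ N`: squarefree level with exactly one split prime `q ≡ 1 (mod 3)`**, all other primes `≡ 2 (mod 3)` non-split.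
[cite: ByeonKim2014, Prop. 4.1] [cite: LingOesterle1991, Thm. 3 and Thm. 6] -/
theorem exists_split_prime_three {f : CuspForm (Gamma0 N) 2} (hf : IsNewform0 f) (hS : ¬ ShimuraIndexPrimeTo 3 f) (h9 : ¬ 9 ∣ N) :
    Squarefree N ∧ ∃ q : ℕ, q.Prime ∧ q ∣ N ∧ q % 3 = 1 ∧ cuspCoeff f q = 1 ∧
      ∀ p : ℕ, p.Prime → p ∣ N → p ≠ q → (p % 3 = 2 ∧ cuspCoeff f p = -1) := by
  have h9' : ¬ 3 ^ 2 ∣ N := by simpa using h9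
  refine ⟨squarefree_of_not_sq_dvd hf (by norm_num) hS h9', ?_⟩
  obtain ⟨q, hq, hqN, -, haq, hd, hrest⟩ := exists_split_prime_of_not_sq_dvd hf (by norm_num) (by norm_num) hS h9'
  refine ⟨q, hq, hqN, by omega, haq, fun p hp hpN hpq ↦ ?_⟩
  obtain ⟨-, ha, hd'⟩ := hrest p hp hpN hpq
  exact ⟨by omega, ha⟩

end Three

/-! ## §3 `3` and `5` never both divide the Shimura index -/

section ThreeFive

variable {N : ℕ} [NeZero N]

/-- With a `3` in the Shimura index, an `11 ∥ N` is NON-SPLIT: `a₁₁(f) = −1` (`3 ∤ 10`). -/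
theorem cuspCoeff_eleven_of_three {f : CuspForm (Gamma0 N) 2} (hf : IsNewform0 f) (hS : ¬ ShimuraIndexPrimeTo 3 f) (h11 : 11 ∣ N)
    (h112 : ¬ 11 ^ 2 ∣ N) : cuspCoeff f 11 = -1 := by
  rcases cuspCoeff_eq_of_not_sq_dvd_of_not_shimuraIndexPrimeTo hf (by norm_num) hS (by norm_num) h11 h112 with ⟨-, hd⟩ | ⟨ha, -⟩
  · exfalso; omega
  · exact ha

/-- With a `5` in the Shimura index, an `11 ∣ N` is simple and SPLIT: `a₁₁(f) = +1` (`5 ∤ 12`). -/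
theorem cuspCoeff_eleven_of_five {f : CuspForm (Gamma0 N) 2} (hf : IsNewform0 f) (hS : ¬ ShimuraIndexPrimeTo 5 f) (h11 : 11 ∣ N) :
    ¬ 11 ^ 2 ∣ N ∧ cuspCoeff f 11 = 1 := by
  have h112 : ¬ 11 ^ 2 ∣ N := not_sq_dvd_of_ne_of_not_shimuraIndexPrimeTo hf (by norm_num) hS (by norm_num) (by norm_num)
  rcases cuspCoeff_eq_of_not_sq_dvd_of_not_shimuraIndexPrimeTo hf (by norm_num) hS (by norm_num) h11 h112 with ⟨ha, -⟩ | ⟨-, hd⟩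
  · exact ⟨h112, ha⟩
  · exfalso; omega

/-- **Newform-only**: if `3` and `5` both divide `[Λ₀(f):Λ₁(f)]` then `11 ∤ N` and `N` is squarefree. -/
theorem not_eleven_dvd_of_three_of_five {f : CuspForm (Gamma0 N) 2} (hf : IsNewform0 f) (h3 : ¬ ShimuraIndexPrimeTo 3 f)
    (h5 : ¬ ShimuraIndexPrimeTo 5 f) : ¬ 11 ∣ N ∧ Squarefree N := by
  refine ⟨fun h11 ↦ ?_, ?_⟩
  · obtain ⟨h112, ha⟩ := cuspCoeff_eleven_of_five hf h5 h11
    have hb := cuspCoeff_eleven_of_three hf h3 h11 h112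
    rw [ha] at hb
    norm_num at hb
  · exact squarefree_of_not_sq_dvd hf (by norm_num) h3
      (not_sq_dvd_of_ne_of_not_shimuraIndexPrimeTo hf (by norm_num) h5 (by norm_num) (by norm_num))

/-- **`3` AND `5` NEVER BOTH DIVIDE THE SHIMURA INDEX** of an `X₀(N)`-datum of a minimal curve (NO optimality hypothesis): the double sieve
makes `N` squarefree and `11 ∤ N`, while ROAD β transported (`ShimuraFive.eleven_dvd_level_of_not_shimuraIndexPrimeTo_five_of_squarefree`)
forces `11 ∣ N`.  With `shimuraIndexPrimeTo_of_seven_le_datum` (support `⊆ {2,3,5}`) the odd part of the Shimura exponent is a prime power.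
[cite: LingOesterle1991, Thm. 6] [cite: AtkinLehner1970, Thm. 3] [cite: Vatsal2005, Rem. 1.8] [cite: ByeonKim2014, Thm. 1.1] -/
theorem not_three_and_five (W : WeierstrassCurve ℚ) [W.IsElliptic] [W.IsGloballyMinimal] (D : ModularParametrizationData W N)
    (h3 : ¬ ShimuraIndexPrimeTo 3 D.f) (h5 : ¬ ShimuraIndexPrimeTo 5 D.f) : False := by
  have hf : IsNewform0 D.f := D.isNewformOf.1
  obtain ⟨h11, hsq⟩ := not_eleven_dvd_of_three_of_five hf h3 h5
  exact h11 (ShimuraFive.eleven_dvd_level_of_not_shimuraIndexPrimeTo_five_of_squarefree W hsq D h5)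

/-- Pointwise form: a `5` in the Shimura index of an `X₀(N)`-datum makes the index prime to `3`, and conversely. -/
theorem shimuraIndexPrimeTo_three_of_five (W : WeierstrassCurve ℚ) [W.IsElliptic] [W.IsGloballyMinimal]
    (D : ModularParametrizationData W N) (h5 : ¬ ShimuraIndexPrimeTo 5 D.f) : ShimuraIndexPrimeTo 3 D.f := by
  by_contra h3
  exact not_three_and_five W D h3 h5

/-- Pointwise form, converse direction: a `3` in the Shimura index of an `X₀(N)`-datum makes the index prime to `5`. [cite: Vatsal2005, Rem. 1.8] -/
theorem shimuraIndexPrimeTo_five_of_three (W : WeierstrassCurve ℚ) [W.IsElliptic] [W.IsGloballyMinimal]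
    (D : ModularParametrizationData W N) (h3 : ¬ ShimuraIndexPrimeTo 3 D.f) : ShimuraIndexPrimeTo 5 D.f := by
  by_contra h5
  exact not_three_and_five W D h3 h5

/-- **The odd support of the Shimura index is a single prime**: for an `X₀(N)`-datum of a minimal curve and odd primes `ℓ₁ ≠ ℓ₂` not both of
`ℓ₁ ∣ [Λ₀:Λ₁]`, `ℓ₂ ∣ [Λ₀:Λ₁]` hold (support `⊆ {2,3,5}` by `shimuraIndexPrimeTo_of_seven_le_datum`, and `{3,5}` by `not_three_and_five`). -/
theorem odd_support_subsingleton (W : WeierstrassCurve ℚ) [W.IsElliptic] [W.IsGloballyMinimal] (D : ModularParametrizationData W N)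
    {ℓ₁ ℓ₂ : ℕ} (hℓ₁ : ℓ₁.Prime) (hℓ₂ : ℓ₂.Prime) (h₁2 : ℓ₁ ≠ 2) (h₂2 : ℓ₂ ≠ 2) (hne : ℓ₁ ≠ ℓ₂)
    (hS₁ : ¬ ShimuraIndexPrimeTo ℓ₁ D.f) (hS₂ : ¬ ShimuraIndexPrimeTo ℓ₂ D.f) : False := by
  -- both primes are `< 7`, odd, hence in `{3, 5}`
  have hsmall : ∀ {ℓ : ℕ}, ℓ.Prime → ℓ ≠ 2 → ¬ ShimuraIndexPrimeTo ℓ D.f → ℓ = 3 ∨ ℓ = 5 := by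
    intro ℓ hℓ hℓ2 hS
    have hlt : ℓ < 7 := by
      by_contra h
      exact hS (ShimuraIndexAtTwo.shimuraIndexPrimeTo_of_seven_le_datum W D hℓ (by omega))
    interval_cases ℓ <;> simp_all (config := {decide := true})
  rcases hsmall hℓ₁ h₁2 hS₁ with rfl | rfl <;> rcases hsmall hℓ₂ h₂2 hS₂ with rfl | rfl
  · exact hne rfl
  · exact not_three_and_five W D hS₁ hS₂
  · exact not_three_and_five W D hS₂ hS₁
  · exact hne rfl

end ThreeFive

end Summit.BirchSwinnertonDyer.BirchSwinnertonDyer.Theorems.ManinLocalTwoThree.ShimuraSieve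

end
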